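import Literature.AnabelianGeometry.EtaleTheta.SettingModelKrullMuTwoInversion
import Literature.AnabelianGeometry.EtaleTheta.SettingModelKrullCuspThm16Origin
import Literature.AnabelianGeometry.EtaleTheta.Discharge.Sec2OuterPairOfCLevelData
import Literature.AnabelianGeometry.EtaleTheta.Discharge.Sec2InvEllOfCLevel
import Literature.AnabelianGeometry.EtaleTheta.Discharge.Sec2InertiaOfCommutatorAxis
import Literature.AnabelianGeometry.EtaleTheta.Discharge.Sec2Prop22InvThetaOfInvEll
import Literature.AnabelianGeometry.EtaleTheta.Discharge.Sec2CoverModelOfCuspLaws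
import Literature.AnabelianGeometry.EtaleTheta.SettingModelKrullCuspLaws
import HarnessLib

/-!
# [EtTh] §2 at the cusped untwisted Krull model: ALL THREE binders of `PiCData.coverDataAx` at the `Π_C` DERIVED
# from the tempered `Π^tp_C`, and the OUTER automorphism pair of Cor. 2.8 (iii) for every `g ∈ Π^tp_C` (non-vacuity)

S. Mochizuki, *The étale theta function and its Frobenioid-theoretic manifestations*, Publ. RIMS **45** (2009) [EtTh]:
§2 p. 35 «`D_x → Π^Θ_X` … maps the inertia group `I_x ⊆ D_x` isomorphically onto `Δ̄_Θ`», p. 36 «`Π_X ⊆ Π_C`», «`ι` …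
“multiplication by `−1`”», Prop. 2.2 (i) p. 37 («`ι` acts on `Δ̄^ell_X` by `−1` and on `Δ̄_Θ` by `+1`»), Cor. 2.8 (iii)
p. 42 («if `γ` arises from an inner automorphism of `Π^tp_{Ċ̲̲}` …») [cite: MochizukiEtTh2009, Prop 2.2 (i) p.37].
Cell abc-iut, layer L2, seat abc-iut-L2-t10 (gen 6), row «COR 2.8 (iii) OUTER-TRANSPORT NV AT THE KRULL CARRIER modelκ′»
(abc-iut-L2-lead R289; obstruction (1) of abc-iut-w5-d118 g5, 12:25:48Z, items (i)–(ii) = K5a/K5b), file 3 of 3, PROOF-ONLY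
(no `def`, no instance, no new `Prop`).

At `e := cLevelDataInvκ' p : (MuTwoSetting.inversionModelκ' p).CLevelData` (K5b; `Π^tp_C = Π^tp_X ⋊_ι ℤ/2` over
`ThetaSetting.modelκ' p`, `ε_± = ι = twistedInversion 1`, commutator-axis cusp):
* §1 at abc-iut-L2-d3's DERIVED profinite bundle `e.piCData : PiCData` (THE completion `Π^tp_C ↪ Π_C`): **hιell**
  (`inv_ell_piCData_inversionModelκ'`, by gen 5's reduction `CLevelData.piCData_inv_ell_of_hinv` p432126 at `g := ε_±` and the
  (R1e′) clause `hinv_conjX_epsPMInvκ'`), **hιtheta** (abc-iut-L6-d6's `PiCData.inv_theta_of_inv_ell`), and — NEW versus every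
  χ-model, where it FAILS (`not_hIx_modelχ'`) — **hIx for every `l > 0`** (`hIx_piCData_inversionModelκ'`, by gen 5's bridge
  `PiCData.inertia_sup_barKer_of_commutatorAxis` p434006 at K3b's `isCompact_cuspDecompκ` / `closure_pair_inl_eta_eq_top` /
  `map_toHat_inertia_modelκ'`); hence `e.piCData.coverDataAx` is BUILT WITH EVERY BINDER A THEOREM and [EtTh] Prop. 2.2
  (i)(ii)(iii) hold there (`prop22_piCData_inversionModelκ'`);
* §2 the same three at the bundle over K4's HAND-BUILT carrier `PiCκ p = Π_X ⋊_{ι̂} ℤ/2` along the completion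
  `toHatCκ` of K5b (`e.piCDataOf (toHatCκ p) …`): the tempered → profinite C-level route of the §1 typing lands on gen 5's `Π_C`;
* §3 **Cor. 2.8 (iii), OUTER case — the automorphism pair EXISTS at `modelκ′` for EVERY `g ∈ Π^tp_C`**
  (`exists_outer_pair_inversionModelκ'`, abc-iut-w6-d051's `CLevelData.exists_outer_pair` p438180 at abc-iut-w5-d165's
  `isQuotientMap_toTheta_modelκ'`), in particular for `g = ε_±`: the residual «pair equations» of the outer chain
  (p436384 / p436513 / p437630) are satisfiable at the commutator-axis-cusp model — abc-iut-w6-d051's `Sec2OuterPairNonVacuity`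
  one model over, now JOINTLY with hIx;
* §4 **`ThetaCovers.TemperedCoverData l` at `modelκ′` with EVERY printed binder DISCHARGED** (item (iii) of abc-iut-w5-d118's
  chain): abc-iut-L2-t7's `CLevelData.exists_temperedCoverData_of_cuspLaws` / `nonempty_…` (p442113) fed with
  `cuspLaws_modelκ'` (p442090), `kerToZIsCompactlyGenerated_modelκ'` (abc-iut-w5-d165 p442699) and hιell above — over
  THE completion and over K4's carrier (`exists_temperedCoverData_toHatCκ`: a tempered cover datum whose `Π_C` IS `PiCκ p`
  and whose `CoverDataAx` is the DERIVED `coverDataAx`);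
* §5 census headline `MuTwoSetting.exists_muTwo_cLevel_all_binders_outer_pair`.
HONEST FRAMING: SEMI-SYNTHETIC model (untwisted Galois action; `Π^tp_C` of the model, not of an orbicurve) — consistency /
non-vacuity evidence for the typed interface ONLY; [EtTh] is refereed, nothing of it is asserted here; no side is taken on
[IUTchIII] Cor. 3.12; typed ≠ proved; instantiated ≠ endorsed; witnessed ≠ discharged-at-the-genuine-curve.
-/

noncomputable section

namespace Literature.AnabelianGeometry.EtaleTheta.SettingModel

open Literature.AnabelianGeometry.SemiGraphs
open _root_.Topology _root_.Function

variable (p : ℕ) [Fact p.Prime]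

/-! ## §1. hιell ∧ hιtheta ∧ hIx at the DERIVED `Π_C`-bundle `(cLevelDataInvκ' p).piCData` -/

/-- **hιell at `(cLevelDataInvκ' p).piCData`** — «`ι` acts on `Δ̄^ell_X` by `−1`» for EVERY `c ∈ Ker(Π_C ↠ G_K) ∖ Π_X` and
`d ∈ Π_X ∩ Ker`, by gen 5's `CLevelData.piCData_inv_ell_of_hinv` with `g := ε_±` (`augC ε_± = 1`, `ε_± ∉ Π^tp_X`) and the
(R1e′) clause of K5b. [cite: MochizukiEtTh2009, Prop 2.2 (i) p.37] -/
theorem inv_ell_piCData_inversionModelκ' (l : ℕ) (eX : (ThetaSetting.modelκ' p).OncePuncturedData) :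
    ∀ c ∈ (cLevelDataInvκ' p).piCData.augGK.ker, c ∉ (cLevelDataInvκ' p).piCData.PiX →
      ∀ d ∈ (cLevelDataInvκ' p).piCData.PiX ⊓ (cLevelDataInvκ' p).piCData.augGK.ker,
        c * d * c⁻¹ * d ∈ (cLevelDataInvκ' p).piCData.barTheta l :=
  (cLevelDataInvκ' p).piCData_inv_ell_of_hinv eX l (g := epsPMInvκ p) (augCInvκ_epsPMInvκ p)
    (epsPMInvκ_not_mem_range p) (hinv_conjX_epsPMInvκ' p)

/-- **hιtheta at the same datum** — «`ι` acts on `Δ̄_Θ` by `+1`» (abc-iut-L6-d6's `PiCData.inv_theta_of_inv_ell`).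
[cite: MochizukiEtTh2009, Prop 2.2 (i) p.37] -/
theorem inv_theta_piCData_inversionModelκ' (l : ℕ) (eX : (ThetaSetting.modelκ' p).OncePuncturedData) :
    ∀ c ∈ (cLevelDataInvκ' p).piCData.augGK.ker, c ∉ (cLevelDataInvκ' p).piCData.PiX →
      ∀ t ∈ (cLevelDataInvκ' p).piCData.barTheta l,
        c * t * c⁻¹ * t⁻¹ ∈ (cLevelDataInvκ' p).piCData.barKer l :=
  (cLevelDataInvκ' p).piCData.inv_theta_of_inv_ell l eX (inv_ell_piCData_inversionModelκ' p l eX)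

/-- **hIx at `(cLevelDataInvκ' p).piCData`, for every `l > 0`** — «`I_x ⥲ Δ̄_Θ`»: `(D_x ∩ Δ_C) · Ker(Δ_X ↠ Δ̄_X)` is the
`Δ̄_Θ`-preimage, by gen 5's commutator-axis bridge at K3b's three clauses of `modelκ′` (compact `D_x`, dense pair `η a, η b`,
inertia `= [η a, η b]^Ẑ`). NEW versus the χ-models, where hIx FAILS (toral cusp). [cite: MochizukiEtTh2009, Def 2.1 p.35] -/
theorem hIx_piCData_inversionModelκ' (l : ℕ) (hl : 0 < l) (eX : (ThetaSetting.modelκ' p).OncePuncturedData)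
    (x : (ThetaSetting.modelκ' p).Pt) :
    ((cLevelDataInvκ' p).piCData.Dx x ⊓ (cLevelDataInvκ' p).piCData.augGK.ker) ⊔ (cLevelDataInvκ' p).piCData.barKer l =
      (cLevelDataInvκ' p).piCData.barTheta l :=
  (cLevelDataInvκ' p).piCData.inertia_sup_barKer_of_commutatorAxis l hl eX x (isCompact_cuspDecompκ p)
    (closure_pair_inl_eta_eq_top p) (map_toHat_inertia_modelκ' p x)

/-- **`coverDataAx` at the DERIVED `Π_C` with every binder a THEOREM, and [EtTh] Prop. 2.2 (i)(ii)(iii) there** (odd `l`):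
gen 4's `PiCData.coverDataAx` fed by `hIx_…` / `inv_ell_…` / `inv_theta_…` above, then abc-iut-L2-t2's named facts by gen 2–3's
`CoverDataAx.prop22_i/ii/iii_holds`. [cite: MochizukiEtTh2009, Prop 2.2 p.37] -/
theorem prop22_piCData_inversionModelκ' (l : ℕ) (hodd : Odd l) (eX : (ThetaSetting.modelκ' p).OncePuncturedData) :
    ((cLevelDataInvκ' p).piCData.coverDataAx l eX (x := ()) trivial hodd
          (hIx_piCData_inversionModelκ' p l (by obtain ⟨k, hk⟩ := hodd; omega) eX ())
          (inv_ell_piCData_inversionModelκ' p l eX) (inv_theta_piCData_inversionModelκ' p l eX)).toCoverData.Prop22_i ∧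
      ((cLevelDataInvκ' p).piCData.coverDataAx l eX (x := ()) trivial hodd
          (hIx_piCData_inversionModelκ' p l (by obtain ⟨k, hk⟩ := hodd; omega) eX ())
          (inv_ell_piCData_inversionModelκ' p l eX) (inv_theta_piCData_inversionModelκ' p l eX)).toCoverData.Prop22_ii ∧
      ((cLevelDataInvκ' p).piCData.coverDataAx l eX (x := ()) trivial hodd
          (hIx_piCData_inversionModelκ' p l (by obtain ⟨k, hk⟩ := hodd; omega) eX ())
          (inv_ell_piCData_inversionModelκ' p l eX) (inv_theta_piCData_inversionModelκ' p l eX)).toCoverData.Prop22_iii :=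
  ⟨ThetaCovers.CoverDataAx.prop22_i_holds _, ThetaCovers.CoverDataAx.prop22_ii_holds _,
    ThetaCovers.CoverDataAx.prop22_iii_holds _⟩

/-! ## §2. The same at the bundle over K4's carrier `PiCκ` along the completion `toHatCκ` -/

/-- **hιell at `piCDataOf (toHatCκ p)`** — the bundle on gen 5's HAND-BUILT `Π_C = Π_X ⋊_{ι̂} ℤ/2` obtained from the tempered
`Π^tp_C` along K5b's completion `toHatCκ`. [cite: MochizukiEtTh2009, Prop 2.2 (i) p.37] -/
theorem inv_ell_piCDataOf_toHatCκ (l : ℕ) (eX : (ThetaSetting.modelκ' p).OncePuncturedData) :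
    ∀ c ∈ ((cLevelDataInvκ' p).piCDataOf (toHatCκ p) (isProfiniteCompletion_toHatCκ p)).augGK.ker,
      c ∉ ((cLevelDataInvκ' p).piCDataOf (toHatCκ p) (isProfiniteCompletion_toHatCκ p)).PiX →
      ∀ d ∈ ((cLevelDataInvκ' p).piCDataOf (toHatCκ p) (isProfiniteCompletion_toHatCκ p)).PiX ⊓
          ((cLevelDataInvκ' p).piCDataOf (toHatCκ p) (isProfiniteCompletion_toHatCκ p)).augGK.ker,
        c * d * c⁻¹ * d ∈ ((cLevelDataInvκ' p).piCDataOf (toHatCκ p) (isProfiniteCompletion_toHatCκ p)).barTheta l :=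
  (cLevelDataInvκ' p).piCDataOf_inv_ell_of_hinv (toHatCκ p) (isProfiniteCompletion_toHatCκ p) eX l (g := epsPMInvκ p)
    (augCInvκ_epsPMInvκ p) (epsPMInvκ_not_mem_range p) (hinv_conjX_epsPMInvκ' p)

/-- **hιtheta at `piCDataOf (toHatCκ p)`.** [cite: MochizukiEtTh2009, Prop 2.2 (i) p.37] -/
theorem inv_theta_piCDataOf_toHatCκ (l : ℕ) (eX : (ThetaSetting.modelκ' p).OncePuncturedData) :
    ∀ c ∈ ((cLevelDataInvκ' p).piCDataOf (toHatCκ p) (isProfiniteCompletion_toHatCκ p)).augGK.ker,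
      c ∉ ((cLevelDataInvκ' p).piCDataOf (toHatCκ p) (isProfiniteCompletion_toHatCκ p)).PiX →
      ∀ t ∈ ((cLevelDataInvκ' p).piCDataOf (toHatCκ p) (isProfiniteCompletion_toHatCκ p)).barTheta l,
        c * t * c⁻¹ * t⁻¹ ∈ ((cLevelDataInvκ' p).piCDataOf (toHatCκ p) (isProfiniteCompletion_toHatCκ p)).barKer l :=
  ((cLevelDataInvκ' p).piCDataOf (toHatCκ p) (isProfiniteCompletion_toHatCκ p)).inv_theta_of_inv_ell l eX
    (inv_ell_piCDataOf_toHatCκ p l eX)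

/-- **hIx at `piCDataOf (toHatCκ p)`, every `l > 0`.** [cite: MochizukiEtTh2009, Def 2.1 p.35] -/
theorem hIx_piCDataOf_toHatCκ (l : ℕ) (hl : 0 < l) (eX : (ThetaSetting.modelκ' p).OncePuncturedData)
    (x : (ThetaSetting.modelκ' p).Pt) :
    (((cLevelDataInvκ' p).piCDataOf (toHatCκ p) (isProfiniteCompletion_toHatCκ p)).Dx x ⊓
        ((cLevelDataInvκ' p).piCDataOf (toHatCκ p) (isProfiniteCompletion_toHatCκ p)).augGK.ker) ⊔
        ((cLevelDataInvκ' p).piCDataOf (toHatCκ p) (isProfiniteCompletion_toHatCκ p)).barKer l =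
      ((cLevelDataInvκ' p).piCDataOf (toHatCκ p) (isProfiniteCompletion_toHatCκ p)).barTheta l :=
  ((cLevelDataInvκ' p).piCDataOf (toHatCκ p) (isProfiniteCompletion_toHatCκ p)).inertia_sup_barKer_of_commutatorAxis l hl
    eX x (isCompact_cuspDecompκ p) (closure_pair_inl_eta_eq_top p) (map_toHat_inertia_modelκ' p x)

/-- The inclusion of `piCDataOf (toHatCκ p)` IS K4's `inl : Π_X ↪ Π_X ⋊_{ι̂} ℤ/2` on the dense image of `Π^tp_X`
(`incl (toHat x) = toHatC (inclX x) = inl (toHat x)`). [cite: MochizukiEtTh2009, Def 2.1 p.36] -/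
theorem piCDataOf_toHatCκ_incl_toHat (x : PiTpκ p) :
    ((cLevelDataInvκ' p).piCDataOf (toHatCκ p) (isProfiniteCompletion_toHatCκ p)).incl ((ThetaSetting.modelκ' p).toHat x) =
      SemidirectProduct.inl (toHatκ p x) := by
  rw [(cLevelDataInvκ' p).piCDataOf_incl_toHat (toHatCκ p) (isProfiniteCompletion_toHatCκ p) x]
  exact toHatCκ_inclInvκ p x

/-! ## §3. Cor. 2.8 (iii), OUTER case: the automorphism pair EXISTS at `modelκ′` -/

/-- **Non-vacuity of the outer pair at `modelκ′`**: every `g ∈ Π^tp_C = Π^tp_X ⋊_ι ℤ/2` has an automorphism pair `(α, β)`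
with `inclX ∘ α = conj_g ∘ inclX`, `β ∘ toTheta = toTheta ∘ α`, `β^{±1}(Δ_Θ) ⊆ Δ_Θ` (abc-iut-w6-d051's
`CLevelData.exists_outer_pair` at `cLevelDataInvκ'` and abc-iut-w5-d165's `isQuotientMap_toTheta_modelκ'`) — the residual
«pair equations» of the OUTER Cor. 2.8 chain at the commutator-axis-cusp model. [cite: MochizukiEtTh2009, Cor 2.8(iii) p.42] -/
theorem exists_outer_pair_inversionModelκ' (g : (MuTwoSetting.inversionModelκ' p).GtpC) :
    ∃ (α : (MuTwoSetting.inversionModelκ' p).PiTemp ≃ₜ* (MuTwoSetting.inversionModelκ' p).PiTemp)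
      (β : (MuTwoSetting.inversionModelκ' p).GtpTheta ≃ₜ* (MuTwoSetting.inversionModelκ' p).GtpTheta),
      (∀ σ, (MuTwoSetting.inversionModelκ' p).inclX (α σ) = g * (MuTwoSetting.inversionModelκ' p).inclX σ * g⁻¹) ∧
      (∀ σ, β ((MuTwoSetting.inversionModelκ' p).toTheta σ) = (MuTwoSetting.inversionModelκ' p).toTheta (α σ)) ∧
      (∀ a, a ∈ (MuTwoSetting.inversionModelκ' p).DeltaTheta → β a ∈ (MuTwoSetting.inversionModelκ' p).DeltaTheta) ∧
      (∀ a, a ∈ (MuTwoSetting.inversionModelκ' p).DeltaTheta → β.symm a ∈ (MuTwoSetting.inversionModelκ' p).DeltaTheta) :=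
  (cLevelDataInvκ' p).exists_outer_pair (isQuotientMap_toTheta_modelκ' p) g

/-- In particular for the GENUINE inversion representative `ε_± = (1, 1̄) ∈ Π^tp_C ∖ Π^tp_X` (whose `α` is `conjX ε_± =
twistedInversionTop 1`, K5b `conjX_epsPMInvκ'`). [cite: MochizukiEtTh2009, Cor 2.8(iii) p.42] -/
theorem exists_outer_pair_inversionModelκ'_epsPM :
    ∃ (α : (MuTwoSetting.inversionModelκ' p).PiTemp ≃ₜ* (MuTwoSetting.inversionModelκ' p).PiTemp)
      (β : (MuTwoSetting.inversionModelκ' p).GtpTheta ≃ₜ* (MuTwoSetting.inversionModelκ' p).GtpTheta),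
      (∀ σ, (MuTwoSetting.inversionModelκ' p).inclX (α σ) =
        (MuTwoSetting.inversionModelκ' p).epsPM * (MuTwoSetting.inversionModelκ' p).inclX σ *
          ((MuTwoSetting.inversionModelκ' p).epsPM)⁻¹) ∧
      (∀ σ, β ((MuTwoSetting.inversionModelκ' p).toTheta σ) = (MuTwoSetting.inversionModelκ' p).toTheta (α σ)) ∧
      (∀ a, a ∈ (MuTwoSetting.inversionModelκ' p).DeltaTheta → β a ∈ (MuTwoSetting.inversionModelκ' p).DeltaTheta) ∧
      (∀ a, a ∈ (MuTwoSetting.inversionModelκ' p).DeltaTheta → β.symm a ∈ (MuTwoSetting.inversionModelκ' p).DeltaTheta) :=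
  exists_outer_pair_inversionModelκ' p (MuTwoSetting.inversionModelκ' p).epsPM

/-- **The pair equations for the EXPLICIT pair** `(conjX g, topCompanion (conjX g))` at `modelκ′` (abc-iut-w6-d051's
`CLevelData.outer_pair_equations`): `β(Δ_Θ) = Δ_Θ` exactly. [cite: MochizukiEtTh2009, Thm 1.6 (ii) p.24] -/
theorem outer_pair_equations_inversionModelκ' (g : (MuTwoSetting.inversionModelκ' p).GtpC) :
    (∀ σ, (MuTwoSetting.inversionModelκ' p).inclX ((cLevelDataInvκ' p).conjX g σ) =
        g * (MuTwoSetting.inversionModelκ' p).inclX σ * g⁻¹) ∧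
    (∀ σ, Thm16Sub.topCompanion (MuTwoSetting.inversionModelκ' p).toThetaSetting (MuTwoSetting.inversionModelκ' p).toThetaSetting
        ((cLevelDataInvκ' p).conjX g) ((cLevelDataInvκ' p).map_deltaTemp_conjX g) (isQuotientMap_toTheta_modelκ' p)
        (isQuotientMap_toTheta_modelκ' p) ((MuTwoSetting.inversionModelκ' p).toTheta σ) =
      (MuTwoSetting.inversionModelκ' p).toTheta ((cLevelDataInvκ' p).conjX g σ)) ∧
    (MuTwoSetting.inversionModelκ' p).DeltaTheta.map (Thm16Sub.topCompanion (MuTwoSetting.inversionModelκ' p).toThetaSetting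
        (MuTwoSetting.inversionModelκ' p).toThetaSetting ((cLevelDataInvκ' p).conjX g) ((cLevelDataInvκ' p).map_deltaTemp_conjX g)
        (isQuotientMap_toTheta_modelκ' p) (isQuotientMap_toTheta_modelκ' p)).toMonoidHom =
      (MuTwoSetting.inversionModelκ' p).DeltaTheta :=
  (cLevelDataInvκ' p).outer_pair_equations (isQuotientMap_toTheta_modelκ' p) g

/-! ## §4. `TemperedCoverData` at `modelκ′`: every printed binder discharged -/

include p in
/-- **`ThetaCovers.TemperedCoverData l` is INHABITED at `modelκ′` with NO residual binder** (odd `l`): abc-iut-L2-t7's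
`nonempty_temperedCoverData_of_cuspLaws` at `cLevelDataInvκ'`, the once-punctured parameters of K3b, `cuspLaws_modelκ'`,
hιell (`inv_ell_piCData_inversionModelκ'`) and L02 `kerToZIsCompactlyGenerated_modelκ'` — all theorems here.
[cite: MochizukiEtTh2009, Def 2.5 p.39] -/
theorem nonempty_temperedCoverData_inversionModelκ' (l : ℕ) (hodd : Odd l) :
    Nonempty (ThetaCovers.TemperedCoverData.{0} l) := by
  obtain ⟨eX⟩ := nonempty_oncePuncturedData_modelκ' p
  exact (cLevelDataInvκ' p).nonempty_temperedCoverData_of_cuspLaws eX (cuspLaws_modelκ' p) hodd (x := ()) trivial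
    (inv_ell_piCData_inversionModelκ' p l eX) (kerToZIsCompactlyGenerated_modelκ' p)

/-- **A tempered cover datum over K4's carrier**: there is `T : TemperedCoverData l` whose profinite part IS the DERIVED
`coverDataAx` on `PiCκ p = Π_X ⋊_{ι̂} ℤ/2` along `toHatCκ` (so `T.PiC = PiCκ p`, `T.Gtp`-side = the tempered `Π^tp_C` of K5a by
abc-iut-L2-d3's assembly), every binder (cusp, hIx, hιell, hιtheta, section, L02) a theorem of the model.
[cite: MochizukiEtTh2009, Def 2.5 p.39] -/
theorem exists_temperedCoverData_toHatCκ (l : ℕ) (hodd : Odd l) (eX : (ThetaSetting.modelκ' p).OncePuncturedData) :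
    ∃ T : ThetaCovers.TemperedCoverData.{0} l,
      T.toCoverDataAx = ((cLevelDataInvκ' p).piCDataOf (toHatCκ p) (isProfiniteCompletion_toHatCκ p)).coverDataAx l eX
        (x := ()) trivial hodd (hIx_piCDataOf_toHatCκ p l (by obtain ⟨k, hk⟩ := hodd; omega) eX ())
        (inv_ell_piCDataOf_toHatCκ p l eX) (inv_theta_piCDataOf_toHatCκ p l eX) :=
  (cLevelDataInvκ' p).exists_temperedCoverData_of_cuspLaws (toHatCκ p) (isProfiniteCompletion_toHatCκ p)
    (toHatCκ_injective p) eX (cuspLaws_modelκ' p) hodd (x := ()) trivial (inv_ell_piCDataOf_toHatCκ p l eX)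
    (kerToZIsCompactlyGenerated_modelκ' p)

/-! ## §5. Census headline -/

/-- **CENSUS HEADLINE (Krull row K5/K6; R289 / R319 obstruction (1)(i)–(ii)).** There are a Def. 1.7 setting `M` (guard
`IsEtThOrigin`, `Compat`, an admissible `ε_Z`, A CUSP, and `ε_±` REALISING a topological inversion `ι` of `Π^tp_X` by
conjugation), C-level data `e : M.CLevelData` and once-punctured parameters such that, at the DERIVED profinite bundle
`e.piCData` (abc-iut-L2-d3), ALL THREE binders hIx (for the cusp, every `l > 0`), hιell, hιtheta of `PiCData.coverDataAx` HOLD,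
AND every `g ∈ Π^tp_C` carries the OUTER automorphism pair of Cor. 2.8 (iii) — witness the cusped untwisted Krull model.
[cite: MochizukiEtTh2009, Cor 2.8(iii) p.42] -/
theorem _root_.Literature.AnabelianGeometry.EtaleTheta.MuTwoSetting.exists_muTwo_cLevel_all_binders_outer_pair
    (l : ℕ) (hl : 0 < l) :
    ∃ (M : MuTwoSetting p) (e : M.CLevelData) (_ : M.toThetaSetting.OncePuncturedData),
      M.toThetaSetting.IsEtThOrigin ∧ M.toThetaSetting.Compat ∧ (∃ εZ : M.GtpC, M.IsAdmissibleEpsZ εZ) ∧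
      (∃ ι : M.PiTemp ≃ₜ* M.PiTemp, ∀ x, M.inclX (ι x) = M.epsPM * M.inclX x * M.epsPM⁻¹) ∧
      (∃ x : M.Pt, M.IsCusp x ∧ (e.piCData.Dx x ⊓ e.piCData.augGK.ker) ⊔ e.piCData.barKer l = e.piCData.barTheta l) ∧
      (∀ c ∈ e.piCData.augGK.ker, c ∉ e.piCData.PiX →
        ∀ d ∈ e.piCData.PiX ⊓ e.piCData.augGK.ker, c * d * c⁻¹ * d ∈ e.piCData.barTheta l) ∧
      (∀ c ∈ e.piCData.augGK.ker, c ∉ e.piCData.PiX →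
        ∀ t ∈ e.piCData.barTheta l, c * t * c⁻¹ * t⁻¹ ∈ e.piCData.barKer l) ∧
      (∀ g : M.GtpC, ∃ (α : M.PiTemp ≃ₜ* M.PiTemp) (β : M.GtpTheta ≃ₜ* M.GtpTheta),
        (∀ σ, M.inclX (α σ) = g * M.inclX σ * g⁻¹) ∧ (∀ σ, β (M.toTheta σ) = M.toTheta (α σ)) ∧
        (∀ a, a ∈ M.DeltaTheta → β a ∈ M.DeltaTheta) ∧ (∀ a, a ∈ M.DeltaTheta → β.symm a ∈ M.DeltaTheta)) := by
  obtain ⟨eX⟩ := nonempty_oncePuncturedData_modelκ' p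
  exact ⟨MuTwoSetting.inversionModelκ' p, cLevelDataInvκ' p, eX, MuTwoSetting.inversionModelκ'_isEtThOrigin p,
    MuTwoSetting.inversionModelκ'_compat p, ⟨_, MuTwoSetting.inversionModelκ'_isAdmissibleEpsZ p⟩,
    ⟨twistedInversionTop (1 : GQp p →* MulAut ZH) (isInducing_leftRightκ p), fun x => (epsPM_conj_inlκ p x).symm⟩,
    ⟨(), trivial, hIx_piCData_inversionModelκ' p l hl eX ()⟩, inv_ell_piCData_inversionModelκ' p l eX,
    inv_theta_piCData_inversionModelκ' p l eX, exists_outer_pair_inversionModelκ' p⟩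

end Literature.AnabelianGeometry.EtaleTheta.SettingModel

end
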